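import Mathlib
import Summits.ValiantsHypothesis.ValiantsHypothesis.Theorems.DivisionGapZeroOneTransferTriPMPowLowerBound

/-!
# Crux `DivisionGap.ZeroOneTransfer` (stmt-ValiantsHypothesis-5066), line `charged-uncharged`, Part D-II′
(lead c12): the typed-peeling ENGINE in reusable form — any constant-margin `F` containing all pure dimer
powers is exponentially hard

`triPM_pow_lower_bound` (p158570) used only two properties of `D_n^M`: all its monomials have first- and
second-vertex sums `M`, and every pure monomial `M·μ_f` (`f` a dimer cover of the rhombus) occurs.  This file
states the engine for ANY such `F` (the form a future disprover of `MonotoneMultiples` at `D_n` will cite) and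
one family of instances beyond powers:

* `typed_pure_lower_bound` — `F ∈ ℝ≥0[x_(v,w)]` with constant margins `M ≥ 1` and
  `M·μ_f ∈ supp F` for all `f ∈ dimers n` ⇒ `T^L ≤ L₊(F) · (T-1)^L` (even `n ≥ 64`, `24 L + 60 ≤ n`).
* `add_unitMargin_pow_lower_bound` — `F = (D_n + G)^M` for any `G ≥ 0` all of whose monomials have unit
  margins (nonnegative combinations of "functional-digraph pairs", e.g. permutation monomials of the vertex
  set: Hamiltonian-cycle or cycle-cover polynomials of any digraph on the rhombus' vertices): adding such
  `G` before powering does not help.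
[cite: Valiant1980, §3 Thm 1] [cite: JerrumSnir1982, §3.1 Lemma 3.1 and §4.3]
-/

noncomputable section

-- `Summit.ValiantsHypothesis.ValiantsHypothesis.…` is the tree's mandated single-conjunct layout
-- (Sub = Summit), so the duplicated namespace component is intended.
set_option linter.dupNamespace false

namespace Summit.ValiantsHypothesis.ValiantsHypothesis.Theorems.DivisionGapZeroOneTransfer

open MvPolynomial
open Literature.Computability.AlgebraicComplexity
open Summit.ValiantsHypothesis.ValiantsHypothesis.Theorems.TriangularDimersDivisionEasy.Negative
open scoped NNReal BigOperators

open TriPMPow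

/-- **The typed-peeling engine.**  Let `F ∈ ℝ≥0[x_(v,w)]` (vertices of the `n × n` rhombus, `n ≥ 64` even)
have all first-vertex sums and all second-vertex sums equal to `M ≥ 1`, and contain every pure monomial
`M·μ_f`, `f` a dimer cover.  Then `T^L ≤ L₊(F) · (T-1)^L` whenever `24 L + 60 ≤ n` (`T = 6^44`).
[cite: Valiant1980, §3 Thm 1] -/
theorem typed_pure_lower_bound :
    ∀ (n M : ℕ) (F : MvPolynomial ((Fin n × Fin n) × (Fin n × Fin n)) ℝ≥0), Even n → 64 ≤ n → 1 ≤ M →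
      (∀ α ∈ F.support, (∀ v, ∑ w, α (v, w) = M) ∧ (∀ w, ∑ v, α (v, w) = M)) →
      (∀ f ∈ dimers n, M • dimerExp f ∈ F.support) →
      ∀ (L : ℕ), 24 * L + 60 ≤ n → Tfib ^ L ≤ complexity F * (Tfib - 1) ^ L := by
  classical
  intro n M F he h64 hM hmarg hpure L hL
  have hn : 0 < n := by omega
  -- typed balanced decomposition of `F`
  obtain ⟨s, hs, a, b, hsum, htyp⟩ := stub_dimerTypedDecomposition n (by omega) F
    (fun _ => M) (fun _ => M) hmarg (fun _ => by omega)
  -- for each term, the typed covers are few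
  have hterm : ∀ t : Fin s,
      Tfib ^ L * ((dimers n).filter fun f => M • dimerExp f ∈ (a t * b t).support).card ≤
        (Tfib - 1) ^ L * (dimers n).card := by
    intro t
    obtain ⟨ρ, γ, hty, hb1, hb2⟩ := htyp t
    set Z : Finset (Fin n × Fin n) := Finset.univ.filter fun i => ρ i ≠ 0 with hZ
    set W : Finset (Fin n × Fin n) := Finset.univ.filter fun i => γ i ≠ 0 with hW
    have hsub : ((dimers n).filter fun f => M • dimerExp f ∈ (a t * b t).support) ⊆
        (dimers n).filter fun f => ∀ x : Fin n × Fin n, (x ∈ Z ↔ f x ∈ W) := by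
      intro f hf
      rw [Finset.mem_filter] at hf ⊢
      refine ⟨hf.1, fun x => ?_⟩
      have hfd : IsDimer f := (Finset.mem_filter.1 hf.1).2
      have key := typed_of_pure_mem_support_mul M hty hfd hf.2 x
      simp only [hZ, hW, Finset.mem_filter, Finset.mem_univ, true_and]
      rw [key]
    obtain ⟨G, hGlen, hGV, hGfar, hGforb⟩ := stub_typedGadgets n hn Z W h64 hb1 hb2
    have hLle : L ≤ G.length := by omega
    set G' := G.take L with hG'
    have hG'len : G'.length = L := by rw [hG', List.length_take]; exact min_eq_left hLle
    have hsubl : G'.Sublist G := List.take_sublist _ _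
    have hpeel := stub_forbiddenPeel n hn Z W G' (fun g hg => hGV g (hsubl.subset hg))
      ((hGfar.sublist (hsubl.map Prod.fst))) (fun g hg => hGforb g (hsubl.subset hg))
    rw [hG'len] at hpeel
    exact (Nat.mul_le_mul_left _ (Finset.card_le_card hsub)).trans hpeel
  -- every cover is served by some term
  have hcov : dimers n ⊆ Finset.univ.biUnion fun t : Fin s =>
      (dimers n).filter fun f => M • dimerExp f ∈ (a t * b t).support := by
    intro f hf
    have hmem : M • dimerExp f ∈ F.support := hpure f hf
    rw [hsum] at hmem
    obtain ⟨t, -, ht⟩ := Finset.mem_biUnion.1 (support_sum hmem)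
    exact Finset.mem_biUnion.2 ⟨t, Finset.mem_univ _, Finset.mem_filter.2 ⟨hf, ht⟩⟩
  have hcard : (dimers n).card ≤ ∑ t : Fin s,
      ((dimers n).filter fun f => M • dimerExp f ∈ (a t * b t).support).card :=
    (Finset.card_le_card hcov).trans Finset.card_biUnion_le
  have hpos : 0 < (dimers n).card := Finset.card_pos.2 (dimers_nonempty he)
  have key : Tfib ^ L * (dimers n).card ≤ s * ((Tfib - 1) ^ L * (dimers n).card) := by
    calc Tfib ^ L * (dimers n).card
        ≤ Tfib ^ L * ∑ t : Fin s, ((dimers n).filter fun f => M • dimerExp f ∈ (a t * b t).support).card :=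
          Nat.mul_le_mul_left _ hcard
      _ = ∑ t : Fin s, Tfib ^ L * ((dimers n).filter fun f => M • dimerExp f ∈ (a t * b t).support).card := by
          rw [Finset.mul_sum]
      _ ≤ ∑ _t : Fin s, (Tfib - 1) ^ L * (dimers n).card := Finset.sum_le_sum fun t _ => hterm t
      _ = s * ((Tfib - 1) ^ L * (dimers n).card) := by simp
  have key2 : Tfib ^ L ≤ s * (Tfib - 1) ^ L := by
    have : Tfib ^ L * (dimers n).card ≤ (s * (Tfib - 1) ^ L) * (dimers n).card := by
      rw [mul_assoc]; exact key
    exact Nat.le_of_mul_le_mul_right this hpos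
  exact key2.trans (Nat.mul_le_mul_right _ hs)

namespace TypedPure

variable {n : ℕ}

/-- Margins of `(D_n + G)^M` when `G` has unit margins. [folklore] -/
theorem margins_add_pow {G : MvPolynomial ((Fin n × Fin n) × (Fin n × Fin n)) ℝ≥0}
    (hG : ∀ α ∈ G.support, (∀ v, ∑ w, α (v, w) = 1) ∧ (∀ w, ∑ v, α (v, w) = 1)) (M : ℕ) :
    ∀ α ∈ ((triPM n + G) ^ M).support, (∀ v, ∑ w, α (v, w) = M) ∧ (∀ w, ∑ v, α (v, w) = M) := by
  classical
  have hunit : ∀ δ ∈ (triPM n + G).support, (∀ v, ∑ w, δ (v, w) = 1) ∧ (∀ w, ∑ v, δ (v, w) = 1) := by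
    intro δ hδ
    rcases Finset.mem_union.1 (support_add hδ) with h | h
    · obtain ⟨f, hf, rfl⟩ := (mem_support_triPM δ).1 h
      have hfd : IsDimer f := (Finset.mem_filter.1 hf).2
      exact ⟨fun v => rowSum_dimerExp f v, fun w => colSum_dimerExp hfd w⟩
    · exact hG δ h
  induction M with
  | zero =>
    intro α hα
    rw [pow_zero, support_one, Finset.mem_singleton] at hα
    subst hα
    simp
  | succ M ih =>
    intro α hα
    rw [pow_succ] at hα
    obtain ⟨β, hβ, δ, hδ, rfl⟩ := Finset.mem_add.mp (support_mul _ _ hα)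
    obtain ⟨hr, hc⟩ := ih β hβ
    obtain ⟨hr1, hc1⟩ := hunit δ hδ
    refine ⟨fun v => ?_, fun w => ?_⟩
    · simp only [Finsupp.coe_add, Pi.add_apply, Finset.sum_add_distrib, hr v, hr1 v]
    · simp only [Finsupp.coe_add, Pi.add_apply, Finset.sum_add_distrib, hc w, hc1 w]

/-- Over `ℝ≥0`, `supp (p^M) ⊆ supp ((p + q)^M)` (the binomial expansion has nonnegative terms). [folklore] -/
theorem support_pow_subset_support_add_pow (p q : MvPolynomial ((Fin n × Fin n) × (Fin n × Fin n)) ℝ≥0) (M : ℕ) :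
    (p ^ M).support ⊆ ((p + q) ^ M).support := by
  classical
  intro m hm
  rw [mem_support_iff] at hm ⊢
  have hexp : (p + q) ^ M = p ^ M + ∑ k ∈ Finset.range M, p ^ k * q ^ (M - k) * (M.choose k : MvPolynomial _ ℝ≥0) := by
    rw [add_pow, Finset.sum_range_succ, Nat.choose_self, Nat.cast_one, mul_one, Nat.sub_self, pow_zero,
      mul_one, add_comm]
  rw [hexp, coeff_add]
  intro h0
  exact hm (add_eq_zero.1 h0).1

end TypedPure

/-- **Adding unit-margin polynomials before powering does not help.**  For any `G ≥ 0` all of whose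
monomials have unit first- and second-vertex sums (e.g. permutation monomials `Π_v x_(v, π v)` of the
vertex set), every power `(D_n + G)^M`, `M ≥ 1`, satisfies `T^L ≤ L₊((D_n + G)^M) · (T-1)^L` for even
`n ≥ 64`, `24 L + 60 ≤ n`. [cite: Valiant1980, §3 Thm 1] -/
theorem add_unitMargin_pow_lower_bound :
    ∀ (n M : ℕ) (G : MvPolynomial ((Fin n × Fin n) × (Fin n × Fin n)) ℝ≥0), Even n → 64 ≤ n → 1 ≤ M →
      (∀ α ∈ G.support, (∀ v, ∑ w, α (v, w) = 1) ∧ (∀ w, ∑ v, α (v, w) = 1)) →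
      ∀ (L : ℕ), 24 * L + 60 ≤ n → Tfib ^ L ≤ complexity ((triPM n + G) ^ M) * (Tfib - 1) ^ L := by
  intro n M G he h64 hM hG L hL
  refine typed_pure_lower_bound n M _ he h64 hM (TypedPure.margins_add_pow hG M) (fun f hf => ?_) L hL
  exact TypedPure.support_pow_subset_support_add_pow _ _ M (smul_dimerExp_mem_support_pow M hf)

end Summit.ValiantsHypothesis.ValiantsHypothesis.Theorems.DivisionGapZeroOneTransfer

end
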